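import Literature.NumberTheory.Weil1964.ArchFollandKroneckerRows
import Literature.RepresentationTheory.ClassicalInvariants.VectorCovectorUnitaryInvariants
import HarnessLib

/-!
# The compact group of a definite place acts on two Folland columns as `U(n)` on `V ⊕ V̄` (junction D4 ↔ FFT)

Topic `NumberTheory/Weil1964`; namespace `Literature.NumberTheory.Weil1964`.  Proved lemmas only: **no named facts, no
records, 0 proof holes**.

LEAF D4 (`ArchFollandKroneckerRows`) computed the rows of the substitution `F ↦ F ∘ V⁻¹` for the Folland unitary
`V = follandUnitaryMatrix D ε (reindex e e (A ⊗ₖ 1))` of a Kronecker element `A ⊗ 1` (the shape of `u ∈ U(V_b)` acting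
on `V ⊗ W` at an archimedean place `b`) under a product scaling `D = D₀ ⊗ D₁`: on the variables of the `W`-column `j`
the element acts through the matrix `Ã^{(j)}`, `Ã = D₀ A D₀⁻¹` read through `signConj ε`.  This file packages that as
the vector–covector action of `ClassicalInvariants/VectorCovectorUnitaryInvariants`:

* §1 `scaledMat D₀ A = D₀ A D₀⁻¹` (entries `(D₀ b / D₀ a) A b a`) and the row coefficient of D4 as
  `signConj ε · (star (scaledMat D₀ A b a))`;
* §2 one column: on `rename (colVar e j) q` the substitution is `rename (colVar e j) ∘ linSubst M` with
  `M = (star Ã)` entrywise-conjugated on a column of sign `ε = +1` (`linSubst_star_follandUnitary_col_pos`) and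
  `M = star Ã` on a column of sign `ε ≠ +1` (`linSubst_star_follandUnitary_col_neg`);
* §3 two columns `jp` (sign `+1`) and `jn` (sign `≠ +1`): on `rename (vcVar e jp jn) F`, `F ∈ ℂ[z, w] =
  MvPolynomial (VCVar n) ℂ`, the substitution is `rename (vcVar e jp jn) ∘ linSubst (vcBlock (star Ã))`
  (**`linSubst_star_follandUnitary_vcVar`**) — the `U(n)`-action `z ↦ ḡ z, w ↦ g w` of the FFT file with `g = Ã^*`;
* §4 at a DEFINITE place (`diag(t)` of one sign, adapted scaling `mm D₀² = ε₀ t`) every `g ∈ U(n)` arises: there is a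
  form-preserving `A ∈ U(diag t)` with `star (scaledMat D₀ A) = g` (**`exists_mem_unitaryGroupOfForm_scaledMat`**);
* §5 hence (**`isVCUnitaryInvariant_of_forall_form`**) a polynomial `rename (vcVar e jp jn) F` fixed by the substitutions
  of all form-preserving Kronecker elements has `F` `U(n)`-invariant in the sense of the FFT file, so
  (`VectorCovectorUnitaryInvariants.isVCUnitaryInvariant_iff`) `F ∈ ℂ[P]`, `P = Σ_a z_a w_a`
  (`mem_span_pairing_pow_of_forall_form`); `rename (vcVar e jp jn) (pairing ℂ n) = pairingPoly` of D3/D4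
  (`rename_vcVar_pairing`).

Use (pub-hodgecm model cell, rows A12/A34, places of kind `Σ₁₂`: `V_b` definite, `W_b = W₊ ⊕ W₋`): this is junction J1 of
`HYPCENSUS-DESIGN` — the per-place classification of `κ`-isotypic homogeneous Fock polynomials at a `Σ₁₂` place is
`ℂ · P^j`.  The converse (each `P^j` is fixed) is D4's `linSubst_star_placeBlock_kronecker_pairingPoly`.

## Mathlib / tree

Mathlib: `Matrix.reindex`, `Matrix.kronecker`, `Matrix.star_apply`, `Matrix.mem_unitaryGroup_iff'`,
`Matrix.GeneralLinearGroup.mkOfDetNeZero`, `Matrix.det_mul`, `MvPolynomial.rename` (`rename_X`, `rename_injective`),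
`MvPolynomial.algHom_ext`.
Tree: D4 `linSubst_star_follandUnitary_kronecker_X`, `isSignBlock_reindex_kronecker_one`; D1 `signConj`
(`signConj_of_eq_one`, `signConj_of_ne_one`, `signConj_mul`), `IsSignBlock`, `follandUnitaryMatrix`;
`Automorphic.UnitaryGroup.unitaryGroupOfForm` (`mem_unitaryGroupOfForm_iff`); `SegalBargmann.linSubst` (`linSubst_X`);
FFT file `VCVar`, `vcBlock`, `linSubst_vcBlock_X_inl/_inr`, `IsVCUnitaryInvariant`, `isVCUnitaryInvariant_iff`,
`pairing`; D3 `pairingPoly`.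

## References
* [Folland1989] G. B. Folland, *Harmonic Analysis in Phase Space*, Princeton UP (1989), Prop. (4.39), Ch. 4 §5.
* [GoodmanWallachGTM255] R. Goodman, N. R. Wallach, *Symmetry, Representations, and Invariants*, GTM 255 (2009),
  Thm 5.2.1.

## Provenance

Written under the LEAN-IN-TREE rule (2026-08-18) for the pub-hodgecm formalisation cell (rows A12/A34 census, junction
J1), binder-2 lane gen 5.  KERNEL only; all statements are proved.
-/

set_option autoImplicit false

noncomputable section

open scoped Matrix Kronecker ComplexConjugate BigOperators
open Complex MvPolynomial
open Literature.Analysis.SegalBargmann Literature.NumberTheory.Automorphic Literature.NumberTheory.Automorphic.UnitaryGroup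
open Literature.RepresentationTheory.ClassicalInvariants

namespace Literature.NumberTheory.Weil1964

/-! ## §1 The scaled matrix `Ã = D₀ A D₀⁻¹` -/

section Scaled

variable {n : ℕ}

/-- **`Ã = D₀ A D₀⁻¹`**, entries `(D₀ b / D₀ a) · A b a`. [folklore] -/
def scaledMat (D₀ : Fin n → ℝ) (A : Matrix (Fin n) (Fin n) ℂ) : Matrix (Fin n) (Fin n) ℂ :=
  Matrix.of fun b a => ((D₀ b / D₀ a : ℝ) : ℂ) * A b a

/-- Entries of `scaledMat`. [folklore] -/
@[simp] theorem scaledMat_apply (D₀ : Fin n → ℝ) (A : Matrix (Fin n) (Fin n) ℂ) (b a : Fin n) :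
    scaledMat D₀ A b a = ((D₀ b / D₀ a : ℝ) : ℂ) * A b a := rfl

/-- **D4's row coefficient through `Ã`**: `(D₀ b / D₀ a) · signConj ε i (star (A b a)) = signConj ε i (star (Ã b a))`.
[folklore] -/
theorem rowCoeff_eq_signConj_star_scaledMat {ι : Type*} (ε : ι → ℝ) (i : ι) (D₀ : Fin n → ℝ)
    (A : Matrix (Fin n) (Fin n) ℂ) (a b : Fin n) :
    ((D₀ b / D₀ a : ℝ) : ℂ) * signConj ε i (star (A b a)) = signConj ε i (star (scaledMat D₀ A b a)) := by
  rw [scaledMat_apply, star_mul', Complex.star_def, Complex.conj_ofReal, signConj_mul, signConj_ofReal]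

end Scaled

/-! ## §2 One `W`-column -/

section Column

variable {n : ℕ} {m ι : Type*} [Fintype m] [DecidableEq m] [Fintype ι] [DecidableEq ι]

/-- The variables of the `W`-column `j`: `a ↦ e (a, j)`. [folklore] -/
def colVar (e : Fin n × m ≃ ι) (j : m) : Fin n → ι := fun a => e (a, j)

omit [Fintype m] [DecidableEq m] [Fintype ι] [DecidableEq ι] in
/-- `colVar` on an index. [folklore] -/
@[simp] theorem colVar_apply (e : Fin n × m ≃ ι) (j : m) (a : Fin n) : colVar e j a = e (a, j) := rfl

omit [Fintype m] [DecidableEq m] [Fintype ι] [DecidableEq ι] in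
/-- `colVar e j` is injective. [folklore] -/
theorem colVar_injective (e : Fin n × m ≃ ι) (j : m) : Function.Injective (colVar e j) :=
  fun _ _ h => (Prod.mk.inj (e.injective h)).1

variable (e : Fin n × m ≃ ι) (A : Matrix (Fin n) (Fin n) ℂ) {D ε : ι → ℝ} {D₀ : Fin n → ℝ} {D₁ : m → ℝ}

omit [Fintype m] in
/-- **Column of sign `+1`**: the substitution acts on `rename (colVar e j) q` as `rename (colVar e j)` of
`linSubst ((star Ã) conjugated entrywise) q` — the `z ↦ ḡ z` half of the vector–covector action with `g = Ã^*`.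
[cite: Folland1989, Prop (4.39)] -/
theorem linSubst_star_follandUnitary_col_pos (hD : ∀ a j, D (e (a, j)) = D₀ a * D₁ j) (hD₁ : ∀ j, D₁ j ≠ 0)
    (hblock : IsSignBlock ε (Matrix.reindex e e (A ⊗ₖ (1 : Matrix m m ℂ)))) {j : m}
    (hεj : ∀ a, ε (e (a, j)) = 1) (q : MvPolynomial (Fin n) ℂ) :
    linSubst (star (follandUnitaryMatrix D ε (Matrix.reindex e e (A ⊗ₖ (1 : Matrix m m ℂ)))))
        (rename (colVar e j) q) =
      rename (colVar e j) (linSubst ((star (scaledMat D₀ A)).map (starRingEnd ℂ)) q) := by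
  have h : (linSubst (star (follandUnitaryMatrix D ε (Matrix.reindex e e (A ⊗ₖ (1 : Matrix m m ℂ)))))).comp
      (rename (colVar e j)) = (rename (colVar e j)).comp (linSubst ((star (scaledMat D₀ A)).map (starRingEnd ℂ))) :=
    MvPolynomial.algHom_ext fun a => by
      rw [AlgHom.comp_apply, AlgHom.comp_apply, rename_X, colVar_apply,
        linSubst_star_follandUnitary_kronecker_X e A hD hD₁ hblock a j, linSubst_X, map_sum]
      refine Finset.sum_congr rfl fun b _ => ?_
      rw [map_mul (rename (colVar e j)), rename_C, rename_X, colVar_apply]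
      congr 2
      rw [rowCoeff_eq_signConj_star_scaledMat, signConj_of_eq_one (hεj a), Matrix.map_apply, Matrix.star_apply,
        Complex.star_def]
  exact AlgHom.congr_fun h q

omit [Fintype m] in
/-- **Column of sign `≠ +1`**: the substitution acts on `rename (colVar e j) q` as `rename (colVar e j)` of
`linSubst (star Ã) q` — the `w ↦ g w` half with `g = Ã^*`. [cite: Folland1989, Prop (4.39)] -/
theorem linSubst_star_follandUnitary_col_neg (hD : ∀ a j, D (e (a, j)) = D₀ a * D₁ j) (hD₁ : ∀ j, D₁ j ≠ 0)
    (hblock : IsSignBlock ε (Matrix.reindex e e (A ⊗ₖ (1 : Matrix m m ℂ)))) {j : m}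
    (hεj : ∀ a, ε (e (a, j)) ≠ 1) (q : MvPolynomial (Fin n) ℂ) :
    linSubst (star (follandUnitaryMatrix D ε (Matrix.reindex e e (A ⊗ₖ (1 : Matrix m m ℂ)))))
        (rename (colVar e j) q) =
      rename (colVar e j) (linSubst (star (scaledMat D₀ A)) q) := by
  have h : (linSubst (star (follandUnitaryMatrix D ε (Matrix.reindex e e (A ⊗ₖ (1 : Matrix m m ℂ)))))).comp
      (rename (colVar e j)) = (rename (colVar e j)).comp (linSubst (star (scaledMat D₀ A))) :=
    MvPolynomial.algHom_ext fun a => by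
      rw [AlgHom.comp_apply, AlgHom.comp_apply, rename_X, colVar_apply,
        linSubst_star_follandUnitary_kronecker_X e A hD hD₁ hblock a j, linSubst_X, map_sum]
      refine Finset.sum_congr rfl fun b _ => ?_
      rw [map_mul (rename (colVar e j)), rename_C, rename_X, colVar_apply]
      congr 2
      rw [rowCoeff_eq_signConj_star_scaledMat, signConj_of_ne_one (hεj a), Matrix.star_apply]
  exact AlgHom.congr_fun h q

end Column

/-! ## §3 Two columns: the vector–covector action -/

section TwoColumns

variable {n : ℕ} {m ι : Type*} [Fintype m] [DecidableEq m] [Fintype ι] [DecidableEq ι]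

/-- The variables of the two columns `jp` (`z`, `inl`) and `jn` (`w`, `inr`). [folklore] -/
def vcVar (e : Fin n × m ≃ ι) (jp jn : m) : VCVar n → ι := Sum.elim (colVar e jp) (colVar e jn)

omit [Fintype m] [DecidableEq m] [Fintype ι] [DecidableEq ι] in
/-- `vcVar` on a `z`-variable. [folklore] -/
@[simp] theorem vcVar_inl (e : Fin n × m ≃ ι) (jp jn : m) (a : Fin n) : vcVar e jp jn (Sum.inl a) = e (a, jp) := rfl

omit [Fintype m] [DecidableEq m] [Fintype ι] [DecidableEq ι] in
/-- `vcVar` on a `w`-variable. [folklore] -/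
@[simp] theorem vcVar_inr (e : Fin n × m ≃ ι) (jp jn : m) (a : Fin n) : vcVar e jp jn (Sum.inr a) = e (a, jn) := rfl

omit [Fintype m] [DecidableEq m] [Fintype ι] [DecidableEq ι] in
/-- `vcVar` is injective when the two columns differ. [folklore] -/
theorem vcVar_injective (e : Fin n × m ≃ ι) {jp jn : m} (hne : jp ≠ jn) : Function.Injective (vcVar e jp jn) := by
  rintro (a | a) (b | b) h
  · exact congrArg Sum.inl ((Prod.mk.inj (e.injective h)).1)
  · exact absurd (Prod.mk.inj (e.injective h)).2 hne
  · exact absurd (Prod.mk.inj (e.injective h)).2.symm hne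
  · exact congrArg Sum.inr ((Prod.mk.inj (e.injective h)).1)

variable (e : Fin n × m ≃ ι) (A : Matrix (Fin n) (Fin n) ℂ) {D ε : ι → ℝ} {D₀ : Fin n → ℝ} {D₁ : m → ℝ}

omit [Fintype m] in
/-- **The Kronecker element acts on the two columns as `vcBlock (star Ã)`**:
`linSubst (star V) (rename vcVar F) = rename vcVar (linSubst (vcBlock (star Ã)) F)`. [cite: Folland1989, Prop (4.39)] -/
theorem linSubst_star_follandUnitary_vcVar (hD : ∀ a j, D (e (a, j)) = D₀ a * D₁ j) (hD₁ : ∀ j, D₁ j ≠ 0)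
    (hblock : IsSignBlock ε (Matrix.reindex e e (A ⊗ₖ (1 : Matrix m m ℂ)))) {jp jn : m}
    (hεp : ∀ a, ε (e (a, jp)) = 1) (hεn : ∀ a, ε (e (a, jn)) ≠ 1) (F : MvPolynomial (VCVar n) ℂ) :
    linSubst (star (follandUnitaryMatrix D ε (Matrix.reindex e e (A ⊗ₖ (1 : Matrix m m ℂ)))))
        (rename (vcVar e jp jn) F) =
      rename (vcVar e jp jn) (linSubst (vcBlock (star (scaledMat D₀ A))) F) := by
  have h : (linSubst (star (follandUnitaryMatrix D ε (Matrix.reindex e e (A ⊗ₖ (1 : Matrix m m ℂ)))))).comp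
      (rename (vcVar e jp jn)) = (rename (vcVar e jp jn)).comp (linSubst (vcBlock (star (scaledMat D₀ A)))) :=
    MvPolynomial.algHom_ext fun x => by
      rcases x with a | a
      · rw [AlgHom.comp_apply, AlgHom.comp_apply, rename_X, vcVar_inl, linSubst_vcBlock_X_inl, map_sum,
          show (X (e (a, jp)) : MvPolynomial ι ℂ) = rename (colVar e jp) (X a) by rw [rename_X, colVar_apply],
          linSubst_star_follandUnitary_col_pos e A hD hD₁ hblock hεp, linSubst_X, map_sum]
        refine Finset.sum_congr rfl fun b _ => ?_
        rw [map_mul (rename (colVar e jp)), rename_C, rename_X, colVar_apply, map_mul (rename (vcVar e jp jn)),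
          rename_C, rename_X, vcVar_inl, Matrix.map_apply]
      · rw [AlgHom.comp_apply, AlgHom.comp_apply, rename_X, vcVar_inr, linSubst_vcBlock_X_inr, map_sum,
          show (X (e (a, jn)) : MvPolynomial ι ℂ) = rename (colVar e jn) (X a) by rw [rename_X, colVar_apply],
          linSubst_star_follandUnitary_col_neg e A hD hD₁ hblock hεn, linSubst_X, map_sum]
        refine Finset.sum_congr rfl fun b _ => ?_
        rw [map_mul (rename (colVar e jn)), rename_C, rename_X, colVar_apply, map_mul (rename (vcVar e jp jn)),
          rename_C, rename_X, vcVar_inr]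
  exact AlgHom.congr_fun h F

omit [Fintype m] [DecidableEq m] [Fintype ι] [DecidableEq ι] in
/-- The pairing of the FFT file becomes D3's `pairingPoly` of the two columns. [folklore] -/
theorem rename_vcVar_pairing (jp jn : m) :
    rename (vcVar e jp jn) (pairing ℂ n) = pairingPoly (colVar e jp) (colVar e jn) := by
  rw [pairing, pairingPoly, map_sum]
  refine Finset.sum_congr rfl fun a _ => ?_
  rw [map_mul, rename_X, rename_X, vcVar_inl, vcVar_inr, colVar_apply, colVar_apply]

end TwoColumns

/-! ## §4 A definite place: every `g ∈ U(n)` comes from a form-preserving `A` -/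

section Surjective

variable {n : ℕ}

/-- **Surjectivity at a definite place.**  For `diag(t)` with adapted scaling `mm D₀_a² = ε₀ t_a` (`mm ≠ 0`, `ε₀ = ±1`,
`t_a ≠ 0`, so `mm ≠ 0`) and any `g ∈ U(n)`, the matrix `A = D₀⁻¹ g^* D₀` preserves the form `diag(t)` and
`star (scaledMat D₀ A) = g`.
[folklore] -/
theorem exists_mem_unitaryGroupOfForm_scaledMat {mm : ℝ} {t D₀ : Fin n → ℝ} {ε₀ : ℝ}
    (ht : ∀ a, t a ≠ 0) (hD : ∀ a, mm * D₀ a ^ 2 = ε₀ * t a) (hε : ε₀ = 1 ∨ ε₀ = -1)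
    (g : Matrix.unitaryGroup (Fin n) ℂ) :
    ∃ A : GL (Fin n) ℂ, A ∈ unitaryGroupOfForm (starRingEnd ℂ) ((Matrix.diagonal t).map Complex.ofRealHom) ∧
      star (scaledMat D₀ (A : Matrix (Fin n) (Fin n) ℂ)) = (g : Matrix (Fin n) (Fin n) ℂ) := by
  have hD0 : ∀ a, D₀ a ≠ 0 := scale_ne_zero_of_adapted (ε := fun _ => ε₀) ht hD (fun _ => hε)
  have hD0' : ∀ a, (D₀ a : ℂ) ≠ 0 := fun a => Complex.ofReal_ne_zero.mpr (hD0 a)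
  -- the candidate and its inverse
  set A₀ : Matrix (Fin n) (Fin n) ℂ :=
    Matrix.of fun b a => ((D₀ a / D₀ b : ℝ) : ℂ) * star ((g : Matrix (Fin n) (Fin n) ℂ) a b) with hA₀
  set B₀ : Matrix (Fin n) (Fin n) ℂ :=
    Matrix.of fun b a => ((D₀ a / D₀ b : ℝ) : ℂ) * (g : Matrix (Fin n) (Fin n) ℂ) b a with hB₀
  have hgg : star (g : Matrix (Fin n) (Fin n) ℂ) * (g : Matrix (Fin n) (Fin n) ℂ) = 1 :=
    Matrix.mem_unitaryGroup_iff'.mp g.2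
  have hAB : A₀ * B₀ = 1 := by
    ext b c
    have hsum : (A₀ * B₀) b c =
        ((D₀ c / D₀ b : ℝ) : ℂ) * (star (g : Matrix (Fin n) (Fin n) ℂ) * (g : Matrix (Fin n) (Fin n) ℂ)) b c := by
      rw [Matrix.mul_apply, Matrix.mul_apply, Finset.mul_sum]
      refine Finset.sum_congr rfl fun a _ => ?_
      rw [hA₀, hB₀, Matrix.of_apply, Matrix.of_apply, Matrix.star_apply]
      have key : ((D₀ a : ℂ))⁻¹ * (D₀ a : ℂ) = 1 := inv_mul_cancel₀ (hD0' a)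
      push_cast
      linear_combination ((D₀ c : ℂ) / (D₀ b : ℂ) * star ((g : Matrix (Fin n) (Fin n) ℂ) a b) *
        (g : Matrix (Fin n) (Fin n) ℂ) a c) * key
    rw [hsum, hgg]
    by_cases hbc : b = c
    · subst hbc; rw [Matrix.one_apply_eq, div_self (hD0 b), Complex.ofReal_one, one_mul]
    · rw [Matrix.one_apply_ne hbc, mul_zero]
  have hdet : A₀.det ≠ 0 := by
    intro h0
    have h1 := congrArg Matrix.det hAB
    rw [Matrix.det_mul, h0, zero_mul, Matrix.det_one] at h1
    exact zero_ne_one h1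
  refine ⟨Matrix.GeneralLinearGroup.mkOfDetNeZero A₀ hdet, ?_, ?_⟩
  · -- form preservation: `Σ_b conj(A b a) t_b A b c = δ_ac t_a`
    rw [mem_unitaryGroupOfForm_iff, Matrix.GeneralLinearGroup.val_mkOfDetNeZero]
    ext a c
    rw [Matrix.mul_apply]
    have hterm : ∀ b, ((A₀.map (starRingEnd ℂ))ᵀ * (Matrix.diagonal t).map Complex.ofRealHom) a b * A₀ b c =
        ((ε₀ * mm * D₀ a * D₀ c : ℝ) : ℂ) *
          ((g : Matrix (Fin n) (Fin n) ℂ) a b * star ((g : Matrix (Fin n) (Fin n) ℂ) c b)) := by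
      intro b
      rw [Matrix.mul_apply, Finset.sum_eq_single b]
      · rw [Matrix.transpose_apply, Matrix.map_apply, Matrix.map_apply, Matrix.diagonal_apply_eq, hA₀,
          Matrix.of_apply, Matrix.of_apply, Complex.ofRealHom_eq_coe, map_mul, Complex.conj_ofReal,
          starRingEnd_apply, star_star]
        have htb : (t b : ℂ) = ((ε₀ * mm * D₀ b ^ 2 : ℝ) : ℂ) := by
          congr 1
          rcases hε with h1 | h1 <;> · subst h1; nlinarith [hD b]
        rw [htb]
        have key : ((D₀ b : ℂ))⁻¹ * (D₀ b : ℂ) = 1 := inv_mul_cancel₀ (hD0' b)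
        push_cast
        linear_combination ((ε₀ : ℂ) * mm * D₀ a * D₀ c * (g : Matrix (Fin n) (Fin n) ℂ) a b *
          star ((g : Matrix (Fin n) (Fin n) ℂ) c b) * (((D₀ b : ℂ))⁻¹ * (D₀ b : ℂ) + 1)) * key
      · intro b' _ hb'
        rw [Matrix.map_apply, Matrix.diagonal_apply_ne _ hb', map_zero, mul_zero]
      · exact fun hb => (hb (Finset.mem_univ b)).elim
    simp only [hterm, ← Finset.mul_sum]
    have hggs : (g : Matrix (Fin n) (Fin n) ℂ) * star (g : Matrix (Fin n) (Fin n) ℂ) = 1 :=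
      Matrix.mem_unitaryGroup_iff.mp g.2
    have hrow := congrFun (congrFun hggs a) c
    rw [Matrix.mul_apply] at hrow
    simp only [Matrix.star_apply] at hrow
    rw [hrow, Matrix.map_apply, Complex.ofRealHom_eq_coe]
    by_cases hac : a = c
    · subst hac
      rw [Matrix.one_apply_eq, mul_one, Matrix.diagonal_apply_eq]
      congr 1
      rcases hε with h1 | h1 <;> · subst h1; nlinarith [hD a]
    · rw [Matrix.one_apply_ne hac, mul_zero, Matrix.diagonal_apply_ne _ hac]; push_cast; ring
  · ext a b
    simp only [Matrix.star_apply, Matrix.GeneralLinearGroup.val_mkOfDetNeZero, scaledMat_apply, hA₀, Matrix.of_apply,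
      star_mul', Complex.star_def, Complex.conj_ofReal, Complex.conj_conj]
    have key : ((D₀ b : ℂ))⁻¹ * (D₀ b : ℂ) = 1 := inv_mul_cancel₀ (hD0' b)
    have key' : ((D₀ a : ℂ))⁻¹ * (D₀ a : ℂ) = 1 := inv_mul_cancel₀ (hD0' a)
    push_cast
    linear_combination ((g : Matrix (Fin n) (Fin n) ℂ) a b * (((D₀ a : ℂ))⁻¹ * (D₀ a : ℂ))) * key +
      ((g : Matrix (Fin n) (Fin n) ℂ) a b) * key'

end Surjective

/-! ## §5 Invariance under the place's compact group ⇒ `U(n)`-invariance ⇒ `ℂ[P]` -/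

section Invariant

variable {n : ℕ} {m ι : Type*} [Fintype m] [DecidableEq m] [Fintype ι] [DecidableEq ι]
variable (e : Fin n × m ≃ ι) {D ε : ι → ℝ} {D₀ : Fin n → ℝ} {D₁ : m → ℝ} {mm : ℝ} {t : Fin n → ℝ} {ε₀ : ℝ}
  {εW : m → ℝ}

omit [Fintype m] in
/-- **Invariance under all form-preserving Kronecker elements of a definite place ⇒ `IsVCUnitaryInvariant`.**
Hypotheses: product scaling `D = D₀ ⊗ D₁` (`D₁ ≠ 0`), adapted `mm D₀² = ε₀ t` with `ε₀ = ±1` CONSTANT (definite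
place), sign vector factoring as `ε (e (a, j)) = ε₀ · ε_W j`, columns `jp` of sign `+1` and `jn ≠ jp` of sign `≠ +1`.
[cite: Folland1989, Prop (4.39)] -/
theorem isVCUnitaryInvariant_of_forall_form (hD : ∀ a j, D (e (a, j)) = D₀ a * D₁ j) (hD₁ : ∀ j, D₁ j ≠ 0)
    (ht : ∀ a, t a ≠ 0) (hD₀ : ∀ a, mm * D₀ a ^ 2 = ε₀ * t a) (hε₀ : ε₀ = 1 ∨ ε₀ = -1)
    (hε : ∀ a j, ε (e (a, j)) = ε₀ * εW j) {jp jn : m} (hjp : ε₀ * εW jp = 1) (hjn : ε₀ * εW jn ≠ 1)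
    (hne : jp ≠ jn) {F : MvPolynomial (VCVar n) ℂ}
    (hF : ∀ A : GL (Fin n) ℂ, A ∈ unitaryGroupOfForm (starRingEnd ℂ) ((Matrix.diagonal t).map Complex.ofRealHom) →
      linSubst (star (follandUnitaryMatrix D ε
          (Matrix.reindex e e ((A : Matrix (Fin n) (Fin n) ℂ) ⊗ₖ (1 : Matrix m m ℂ)))))
        (rename (vcVar e jp jn) F) = rename (vcVar e jp jn) F) :
    IsVCUnitaryInvariant F := by
  intro g
  obtain ⟨A, hA, hg⟩ := exists_mem_unitaryGroupOfForm_scaledMat ht hD₀ hε₀ g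
  have hblock : IsSignBlock ε (Matrix.reindex e e ((A : Matrix (Fin n) (Fin n) ℂ) ⊗ₖ (1 : Matrix m m ℂ))) :=
    isSignBlock_reindex_kronecker_one e _ (εV := fun _ => ε₀) (fun _ _ h => absurd rfl h) hε
  have h := hF A hA
  rw [linSubst_star_follandUnitary_vcVar e _ hD hD₁ hblock (fun a => by rw [hε, hjp])
    (fun a => by rw [hε]; exact hjn), hg] at h
  exact rename_injective _ (vcVar_injective e hne) h

omit [Fintype m] in
/-- **… hence such a polynomial is a polynomial in the pairing `P = Σ_a z_a w_a`** (FFT for `U(n)`, `n ≥ 1`).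
[cite: GoodmanWallachGTM255, Thm 5.2.1] -/
theorem mem_span_pairing_pow_of_forall_form [NeZero n] (hD : ∀ a j, D (e (a, j)) = D₀ a * D₁ j)
    (hD₁ : ∀ j, D₁ j ≠ 0) (ht : ∀ a, t a ≠ 0) (hD₀ : ∀ a, mm * D₀ a ^ 2 = ε₀ * t a)
    (hε₀ : ε₀ = 1 ∨ ε₀ = -1) (hε : ∀ a j, ε (e (a, j)) = ε₀ * εW j) {jp jn : m} (hjp : ε₀ * εW jp = 1)
    (hjn : ε₀ * εW jn ≠ 1) (hne : jp ≠ jn) {F : MvPolynomial (VCVar n) ℂ}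
    (hF : ∀ A : GL (Fin n) ℂ, A ∈ unitaryGroupOfForm (starRingEnd ℂ) ((Matrix.diagonal t).map Complex.ofRealHom) →
      linSubst (star (follandUnitaryMatrix D ε
          (Matrix.reindex e e ((A : Matrix (Fin n) (Fin n) ℂ) ⊗ₖ (1 : Matrix m m ℂ)))))
        (rename (vcVar e jp jn) F) = rename (vcVar e jp jn) F) :
    F ∈ Submodule.span ℂ (Set.range fun k : ℕ => pairing ℂ n ^ k) :=
  (isVCUnitaryInvariant_iff F).mp (isVCUnitaryInvariant_of_forall_form e hD hD₁ ht hD₀ hε₀ hε hjp hjn hne hF)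

end Invariant

end Literature.NumberTheory.Weil1964

end
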